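import Summits.ValiantsHypothesis.ValiantsHypothesis.Theorems.LacunarySymmetroidMatrixDescartesDoorA26WallBubblingSignWord

/-!
# `DoorA26` / line `wall_bubbling` — SECOND ORDER AT A BALANCED TOUCH: the tangent plane of the null cone contains no timelike vector

HONEST FRAMING.  Object-search cell `pub-symmetroid`, crux `Theses.LacunarySymmetroid.DoorA26` (stmt-ValiantsHypothesis-19979; OPEN, typed,
never asserted).  W2 seat val-sym-door-p1 g18, file #52; def-free helper for obligation (R) of `Cruxes/DoorA26/Lines/wall_bubbling.lean`, a footnote to
#46 `…SignWord` (the Q-lift `mem_twentyLocus_of_touches_alternations_pencilShift`, whose clause at an abscissa with `det P = 0` and vanishing first-order push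
`polar(P,Q) = 0` asks for `0 < κ_j det Q`) and #47 (balanced profiles = the first-order residual).

WHAT IS HERE.  `det_nonpos_of_polar_eq_zero`: for real symmetric `2 × 2` matrices, if `P` is singular and non-zero (a rank-one touch matrix, a null vector of
`(Sym₂ℝ, det) ≅ ℝ^{1,2}`) and `polar(P,Q) := det(P+Q) − det P − det Q = 0`, then `det Q ≤ 0`: the `det`-orthogonal complement of a null vector is the tangent
plane of the cone, which contains no timelike vector (in coordinates `a²·det Q = −(a q₀₁ − b q₀₀)²` when `P = [[a,b],[b,c]]`, `ac = b²`).  Consequence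
`kappa_neg_of_secondOrder_touch`: at a rank-one touch where the first-order push vanishes, the Q-lift's second-order clause `0 < κ_j det Q(τ_j)` can only hold
with `κ_j < 0` — an INSIDE touch (determinant positive nearby, to be pushed down); OUTSIDE touches (`κ_j > 0`) with vanishing first-order push are not
second-order liftable by `det Q`.  READING for (R): in a balanced profile the touches of the balance support that are outside touches are the genuinely stuck
ones (seat memo §10).  Nothing here bears on `DoorA26`, `DoorA34`, (W)/(M)/(R), `MatrixDescartes` (18050) or `VP ≠ VNP`; registers unchanged.

[folklore] Lorentz geometry of `Sym₂(ℝ)`; [this work] the packaging.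
-/

-- `Summit.ValiantsHypothesis.ValiantsHypothesis.…` repeats a component by the D-0017 layout
-- (single-conjunct summit), which the `dupNamespace` linter flags; the name is mandated.
set_option linter.dupNamespace false

namespace Summit.ValiantsHypothesis.ValiantsHypothesis.Theorems.LacunarySymmetroidMatrixDescartes.WallBubbling

/-- **The tangent plane of the null cone contains no timelike vector.**  `P` symmetric, singular, non-zero; `Q` symmetric with
`det(P+Q) − det P − det Q = 0` ⇒ `det Q ≤ 0`. [folklore] -/
theorem det_nonpos_of_polar_eq_zero (P Q : Matrix (Fin 2) (Fin 2) ℝ) (hP : P.IsSymm) (hQ : Q.IsSymm) (hdet : P.det = 0) (hne : P ≠ 0)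
    (hpol : (P + Q).det - P.det - Q.det = 0) : Q.det ≤ 0 := by
  have hPs : P 1 0 = P 0 1 := hP.apply 0 1
  have hQs : Q 1 0 = Q 0 1 := hQ.apply 0 1
  simp only [Matrix.det_fin_two, Matrix.add_apply] at hdet hpol ⊢
  rw [hPs] at hdet hpol; rw [hQs] at hpol ⊢
  -- some entry of `P` is non-zero
  have hentry : P 0 0 ≠ 0 ∨ P 1 1 ≠ 0 := by
    by_contra h
    push Not at h
    obtain ⟨h00, h11⟩ := h
    have h01 : P 0 1 = 0 := by nlinarith
    apply hne
    ext i j; fin_cases i <;> fin_cases j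
    · exact h00
    · exact h01
    · show P 1 0 = 0
      rw [hPs]; exact h01
    · exact h11
  rcases hentry with ha | hc
  · have key : P 0 0 ^ 2 * (Q 0 0 * Q 1 1 - Q 0 1 * Q 0 1) = -(P 0 0 * Q 0 1 - P 0 1 * Q 0 0) ^ 2 := by
      linear_combination (P 0 0 * Q 0 0) * hpol - Q 0 0 ^ 2 * hdet
    have h2 : 0 < P 0 0 ^ 2 := by positivity
    nlinarith [sq_nonneg (P 0 0 * Q 0 1 - P 0 1 * Q 0 0)]
  · have key : P 1 1 ^ 2 * (Q 0 0 * Q 1 1 - Q 0 1 * Q 0 1) = -(P 1 1 * Q 0 1 - P 0 1 * Q 1 1) ^ 2 := by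
      linear_combination (P 1 1 * Q 1 1) * hpol - Q 1 1 ^ 2 * hdet
    have h2 : 0 < P 1 1 ^ 2 := by positivity
    nlinarith [sq_nonneg (P 1 1 * Q 0 1 - P 0 1 * Q 1 1)]

/-- **Second-order pushes at a balanced touch go DOWN only.**  At a rank-one touch (`det P(τ) = 0 ≠ P(τ)`) where the first-order push of the Q-shift
vanishes, `0 < κ · det Q(τ)` forces `κ < 0`. [this work] -/
theorem kappa_neg_of_secondOrder_touch (P Q : Matrix (Fin 2) (Fin 2) ℝ) (hP : P.IsSymm) (hQ : Q.IsSymm) (hdet : P.det = 0) (hne : P ≠ 0)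
    (hpol : (P + Q).det - P.det - Q.det = 0) {κ : ℝ} (hκ : 0 < κ * Q.det) : κ < 0 := by
  have h := det_nonpos_of_polar_eq_zero P Q hP hQ hdet hne hpol
  by_contra hk
  push Not at hk
  have : κ * Q.det ≤ 0 := mul_nonpos_of_nonneg_of_nonpos hk h
  linarith

end Summit.ValiantsHypothesis.ValiantsHypothesis.Theorems.LacunarySymmetroidMatrixDescartes.WallBubbling
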